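import Mathlib
import Summits.NavierStokesRegularity.NavierStokesRegularity.Theorems.EulerZoomLiouvillePowerGaugeEulerLiouvilleNeedleStretchingCriterion

/-!
# ORBITWISE STRETCHING MAJORANT + SUBCRITICAL VISITS ARE SHORT (plate t40h′, nsreg-p2 g33's spec; ROUND-41 (E3)(b)/(IM0))

Width piece for crux `EulerZoomLiouville.PowerGaugeEulerLiouville` (stmt-NavierStokesRegularity-19832), by name under
LEAD 19832 (ns-typeII-p2 g12); seat ns-in-ser-c g3 (director-ns inputs-36), `--supports stmt-NavierStokesRegularity-19832
--as helper`.  Sequel of t40h `…NeedleStretchingCriterion` (p649477): the proof of the stretching inequality uses the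
majorant `⟪DU v, v⟫ ≤ s‖v‖²` only AT ORBIT POINTS, so the spatial majorant may be replaced by a TIME majorant along the
orbit, `⟪DU(Ψ_τ y) v, v⟫ ≤ s(τ)‖v‖²` for `τ ∈ [0, L]` (`s : ℝ → ℝ` continuous):

* (T1′) `norm_curl_sq_mul_exp_le_linger_orbit` — `‖Ω(y)‖² · exp(2∫₀^σ (1 − s τ) dτ) ≤ ‖Ω(Ψ_σ y)‖²` (`σ ∈ [0, L]`;
  `monotoneOn_weightedVorticity_linger_orbit`);
* (T2′) `integral_one_sub_stretching_le_log_linger_orbit` — `∫₀^σ (1 − s τ) dτ ≤ log(O/‖Ω(y)‖)`;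
* (V) `linger_length_le_of_subcritical_visit` — **SUBCRITICAL VISITS ARE SHORT**: if every stretching rate along the
  orbit is `≤ s₀ < 1` on `[0, L]` then `L ≤ log(O/‖Ω(y)‖)/(1 − s₀)`;
* (IM0) `volume_subcriticalStretching_le` — TWO-LEVEL form (ROUND-41 §6 (IM0)): with a continuous spatial majorant `s ≤ S` on
  `B̄_M` and a level `q < S`, `(S − q)·vol{τ ∈ [0, σ] : s(Ψ_τ y) ≤ q} ≤ log(O/‖Ω(y)‖) + (S − 1)σ` — the orbit-side companion of
  t40f (C3) `volume_highCompression_ge`.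

READING (R41 (E3)(b)): a vortical label's visit to a region where every stretching rate is `≤ s₀ < 1` (e.g. near a SOURCE of
`W`, where t41a gives `≤ 2γ`) lasts at most `log(O/ω_entry)/(1 − s₀)`; an ETERNAL lingerer therefore cannot converge to a
source.  The consumer re-bases at the entry point (`IsUniformlyLipschitzOn.evolutionMap_trans`).
HONEST FRAMING: statements about the flow of HYPOTHETICAL self-similar Euler profiles; nothing here proves the crux E (19832
OPEN), any door Target, or any Navier–Stokes regularity statement; no summit statement is touched. [folklore (Grönwall)]
-/

noncomputable section

open Set Filter Topology Metric Function MeasureTheory intervalIntegral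
open scoped RealInnerProductSpace NNReal ENNReal

set_option linter.dupNamespace false

namespace Summit.NavierStokesRegularity.NavierStokesRegularity.Theorems.PowerGaugeEulerLiouville.NeedleClock

open Literature.Analysis Literature.Analysis.FluidPDE
open Summit.NavierStokesRegularity.NavierStokesRegularity.Theorems.PowerGaugeEulerLiouville

variable {γ : ℝ} {U V : EuclideanSpace ℝ (Fin 3) → EuclideanSpace ℝ (Fin 3)} {P : EuclideanSpace ℝ (Fin 3) → ℝ}

/-- **The weighted enstrophy is monotone along a lingering orbit (orbitwise majorant).**  With a continuous TIME majorant
`s` (`⟪DU(Ψ_τ y) v, v⟫ ≤ s(τ)‖v‖²` for `τ ∈ [0, L]`), `r ↦ exp(−2∫₀^r (1 − s τ) dτ) · ‖Ω(Ψ_r y)‖²` is monotone on `[0, L]`.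
[folklore] -/
theorem monotoneOn_weightedVorticity_linger_orbit (hprof : IsSelfSimilarEulerProfile γ 0 U P) (hV : ContDiff ℝ 1 V)
    {K : ℝ} (hK : ∀ y, ‖fderiv ℝ V y‖ ≤ K) {M Rbig : ℝ} (hMR : M < Rbig)
    (hVU : ∀ w ∈ ball (0 : EuclideanSpace ℝ (Fin 3)) Rbig, V w = U w)
    {y : EuclideanSpace ℝ (Fin 3)} {L : ℝ} {s : ℝ → ℝ} (hsc : Continuous s)
    (hs : ∀ τ ∈ Icc (0 : ℝ) L, ∀ v,
      ⟪fderiv ℝ U (ODE.evolutionMap (fun _ : ℝ => selfSimilarTransport γ 0 V) 0 (-τ) y) v, v⟫ ≤ s τ * ‖v‖ ^ 2)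
    (hy : ∀ σ ∈ Icc (0 : ℝ) L, ‖ODE.evolutionMap (fun _ : ℝ => selfSimilarTransport γ 0 V) 0 (-σ) y‖ ≤ M) :
    MonotoneOn (fun r => Real.exp (-(2 * ∫ τ in (0:ℝ)..r, (1 - s τ))) *
      ‖curl U (ODE.evolutionMap (fun _ : ℝ => selfSimilarTransport γ 0 V) 0 (-r) y)‖ ^ 2) (Icc (0 : ℝ) L) := by
  set Ψ : ℝ → EuclideanSpace ℝ (Fin 3) := fun r => ODE.evolutionMap (fun _ : ℝ => selfSimilarTransport γ 0 V) 0 (-r) y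
    with hΨ
  -- the integrand `1 − s` and its primitive
  set a : ℝ → ℝ := fun τ => 1 - s τ with ha
  have hac : Continuous a := continuous_const.sub hsc
  set g : ℝ → ℝ := fun r => ∫ τ in (0:ℝ)..r, a τ with hg
  have hg' : ∀ r, HasDerivAt g (a r) r := fun r => (hac.integral_hasStrictDerivAt 0 r).hasDerivAt
  -- the enstrophy along the orbit
  set φ : ℝ → ℝ := fun r => ‖curl U (Ψ r)‖ ^ 2 with hφ
  have hball : ∀ r ∈ Icc (0 : ℝ) L, Ψ r ∈ ball (0 : EuclideanSpace ℝ (Fin 3)) Rbig := fun r hr =>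
    mem_ball_zero_iff.2 (lt_of_le_of_lt (hy r hr) hMR)
  have hφ' : ∀ r ∈ Icc (0 : ℝ) L, HasDerivAt φ (2 * (‖curl U (Ψ r)‖ ^ 2 -
      ⟪curl U (Ψ r), fderiv ℝ U (Ψ r) (curl U (Ψ r))⟫)) r := fun r hr =>
    hasDerivAt_norm_curl_flow_sq hprof hV hK hVU y (hball r hr)
  -- the weighted enstrophy `F = exp(−2g) · φ`
  set F : ℝ → ℝ := fun r => Real.exp (-(2 * g r)) * φ r with hF
  have hF' : ∀ r ∈ Icc (0 : ℝ) L, HasDerivAt F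
      (Real.exp (-(2 * g r)) * (-(2 * a r)) * φ r +
        Real.exp (-(2 * g r)) * (2 * (‖curl U (Ψ r)‖ ^ 2 - ⟪curl U (Ψ r), fderiv ℝ U (Ψ r) (curl U (Ψ r))⟫))) r := by
    intro r hr
    have h1 : HasDerivAt (fun r => Real.exp (-(2 * g r))) (Real.exp (-(2 * g r)) * (-(2 * a r))) r :=
      (((hg' r).const_mul 2).neg).exp
    exact h1.mul (hφ' r hr)
  have hF'nn : ∀ r ∈ Icc (0 : ℝ) L, 0 ≤ Real.exp (-(2 * g r)) * (-(2 * a r)) * φ r +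
      Real.exp (-(2 * g r)) * (2 * (‖curl U (Ψ r)‖ ^ 2 - ⟪curl U (Ψ r), fderiv ℝ U (Ψ r) (curl U (Ψ r))⟫)) := by
    intro r hr
    have hsr := hs r hr (curl U (Ψ r))
    rw [real_inner_comm] at hsr
    have he : 0 < Real.exp (-(2 * g r)) := Real.exp_pos _
    have hcalc : Real.exp (-(2 * g r)) * (-(2 * a r)) * φ r +
        Real.exp (-(2 * g r)) * (2 * (‖curl U (Ψ r)‖ ^ 2 - ⟪curl U (Ψ r), fderiv ℝ U (Ψ r) (curl U (Ψ r))⟫)) =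
        Real.exp (-(2 * g r)) * (2 * (s r * ‖curl U (Ψ r)‖ ^ 2 -
          ⟪curl U (Ψ r), fderiv ℝ U (Ψ r) (curl U (Ψ r))⟫)) := by
      simp only [ha, hφ]; ring
    rw [hcalc]
    exact mul_nonneg he.le (by linarith)
  have hFc : ContinuousOn F (Icc (0 : ℝ) L) := fun r hr => (hF' r hr).continuousAt.continuousWithinAt
  have hmono := monotoneOn_of_hasDerivWithinAt_nonneg (convex_Icc (0 : ℝ) L) hFc
    (fun r hr => (hF' r (interior_subset hr)).hasDerivWithinAt) (fun r hr => hF'nn r (interior_subset hr))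
  simpa [hF, hg, ha, hφ, hΨ] using hmono

/-- **(T1′) THE STRETCHING INEQUALITY, orbitwise majorant.**  For every `σ ∈ [0, L]`:
`‖Ω(y)‖² · exp(2∫₀^σ (1 − s τ) dτ) ≤ ‖Ω(Ψ_σ y)‖²`. [folklore] -/
theorem norm_curl_sq_mul_exp_le_linger_orbit (hprof : IsSelfSimilarEulerProfile γ 0 U P) (hV : ContDiff ℝ 1 V)
    {K : ℝ} (hK : ∀ y, ‖fderiv ℝ V y‖ ≤ K) {M Rbig : ℝ} (hMR : M < Rbig)
    (hVU : ∀ w ∈ ball (0 : EuclideanSpace ℝ (Fin 3)) Rbig, V w = U w)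
    {y : EuclideanSpace ℝ (Fin 3)} {L : ℝ} {s : ℝ → ℝ} (hsc : Continuous s)
    (hs : ∀ τ ∈ Icc (0 : ℝ) L, ∀ v,
      ⟪fderiv ℝ U (ODE.evolutionMap (fun _ : ℝ => selfSimilarTransport γ 0 V) 0 (-τ) y) v, v⟫ ≤ s τ * ‖v‖ ^ 2)
    (hy : ∀ σ ∈ Icc (0 : ℝ) L, ‖ODE.evolutionMap (fun _ : ℝ => selfSimilarTransport γ 0 V) 0 (-σ) y‖ ≤ M) :
    ∀ σ ∈ Icc (0 : ℝ) L,
      ‖curl U y‖ ^ 2 * Real.exp (2 * ∫ τ in (0:ℝ)..σ, (1 - s τ)) ≤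
        ‖curl U (ODE.evolutionMap (fun _ : ℝ => selfSimilarTransport γ 0 V) 0 (-σ) y)‖ ^ 2 := by
  intro σ hσ
  have hmono := monotoneOn_weightedVorticity_linger_orbit hprof hV hK hMR hVU hsc hs hy
  have h0 : (0 : ℝ) ∈ Icc (0 : ℝ) L := ⟨le_rfl, hσ.1.trans hσ.2⟩
  have h := hmono h0 hσ hσ.1
  simp only [intervalIntegral.integral_same, mul_zero, neg_zero, Real.exp_zero, one_mul,
    ODE.evolutionMap_self] at h
  set I := ∫ τ in (0:ℝ)..σ, (1 - s τ) with hI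
  have hexp : Real.exp (2 * I) * Real.exp (-(2 * I)) = 1 := by
    rw [← Real.exp_add, add_neg_cancel, Real.exp_zero]
  calc ‖curl U y‖ ^ 2 * Real.exp (2 * I)
      ≤ (Real.exp (-(2 * I)) * ‖curl U (ODE.evolutionMap (fun _ : ℝ => selfSimilarTransport γ 0 V) 0 (-σ) y)‖ ^ 2) *
          Real.exp (2 * I) := mul_le_mul_of_nonneg_right h (Real.exp_pos _).le
    _ = ‖curl U (ODE.evolutionMap (fun _ : ℝ => selfSimilarTransport γ 0 V) 0 (-σ) y)‖ ^ 2 := by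
          rw [mul_comm (Real.exp _), mul_assoc, mul_comm (Real.exp (-(2 * I))), hexp, mul_one]

/-- **(T2′) THE STRETCHING CRITERION, orbitwise majorant, logarithmic form.**  With `‖Ω‖ ≤ O` on `B̄_M` and
`Ω(y) ≠ 0`: `∫₀^σ (1 − s τ) dτ ≤ log(O / ‖Ω(y)‖)` for every `σ ∈ [0, L]`. [folklore] -/
theorem integral_one_sub_stretching_le_log_linger_orbit (hprof : IsSelfSimilarEulerProfile γ 0 U P)
    (hV : ContDiff ℝ 1 V) {K : ℝ} (hK : ∀ y, ‖fderiv ℝ V y‖ ≤ K) {M Rbig : ℝ} (hMR : M < Rbig)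
    (hVU : ∀ w ∈ ball (0 : EuclideanSpace ℝ (Fin 3)) Rbig, V w = U w)
    {O : ℝ} (hO : ∀ z ∈ closedBall (0 : EuclideanSpace ℝ (Fin 3)) M, ‖curl U z‖ ≤ O)
    {y : EuclideanSpace ℝ (Fin 3)} (hΩ : curl U y ≠ 0) {L : ℝ} {s : ℝ → ℝ} (hsc : Continuous s)
    (hs : ∀ τ ∈ Icc (0 : ℝ) L, ∀ v,
      ⟪fderiv ℝ U (ODE.evolutionMap (fun _ : ℝ => selfSimilarTransport γ 0 V) 0 (-τ) y) v, v⟫ ≤ s τ * ‖v‖ ^ 2)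
    (hy : ∀ σ ∈ Icc (0 : ℝ) L, ‖ODE.evolutionMap (fun _ : ℝ => selfSimilarTransport γ 0 V) 0 (-σ) y‖ ≤ M) :
    ∀ σ ∈ Icc (0 : ℝ) L, ∫ τ in (0:ℝ)..σ, (1 - s τ) ≤ Real.log (O / ‖curl U y‖) := by
  intro σ hσ
  set I := ∫ τ in (0:ℝ)..σ, (1 - s τ) with hI
  have hω : 0 < ‖curl U y‖ := norm_pos_iff.2 hΩ
  have hT1 := norm_curl_sq_mul_exp_le_linger_orbit hprof hV hK hMR hVU hsc hs hy σ hσ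
  have hOσ := hO _ (mem_closedBall_zero_iff.2 (hy σ hσ))
  have h1 : ‖curl U y‖ ^ 2 * Real.exp (2 * I) ≤ O ^ 2 :=
    hT1.trans (pow_le_pow_left₀ (norm_nonneg _) hOσ 2)
  have hOpos : 0 < O := by
    have h00 := hO _ (mem_closedBall_zero_iff.2 (hy 0 ⟨le_rfl, hσ.1.trans hσ.2⟩))
    rw [neg_zero, ODE.evolutionMap_self] at h00
    exact hω.trans_le h00
  have h2 : Real.exp (2 * I) ≤ (O / ‖curl U y‖) ^ 2 := by
    rw [div_pow, le_div_iff₀ (by positivity)]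
    linarith [h1]
  have h3 : 2 * I ≤ Real.log ((O / ‖curl U y‖) ^ 2) := by
    rw [← Real.log_exp (2 * I)]
    exact Real.log_le_log (Real.exp_pos _) h2
  rw [Real.log_pow] at h3
  push_cast at h3
  linarith

/-- **(V) SUBCRITICAL VISITS ARE SHORT.**  If along the lingering orbit every stretching rate is `≤ s₀ < 1` on `[0, L]`
(`⟪DU(Ψ_τ y) v, v⟫ ≤ s₀‖v‖²`), then `L ≤ log(O/‖Ω(y)‖)/(1 − s₀)`: a vortical label's visit to a subcritically stretching
region (e.g. near a SOURCE of the similarity wind, where the rates are `≤ 2γ`) lasts at most `log(O/ω_entry)/(1 − s₀)`.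
[folklore] -/
theorem linger_length_le_of_subcritical_visit (hprof : IsSelfSimilarEulerProfile γ 0 U P) (hV : ContDiff ℝ 1 V)
    {K : ℝ} (hK : ∀ y, ‖fderiv ℝ V y‖ ≤ K) {M Rbig : ℝ} (hMR : M < Rbig)
    (hVU : ∀ w ∈ ball (0 : EuclideanSpace ℝ (Fin 3)) Rbig, V w = U w)
    {O : ℝ} (hO : ∀ z ∈ closedBall (0 : EuclideanSpace ℝ (Fin 3)) M, ‖curl U z‖ ≤ O)
    {y : EuclideanSpace ℝ (Fin 3)} (hΩ : curl U y ≠ 0) {L : ℝ} {s₀ : ℝ} (hs0 : s₀ < 1)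
    (hvisit : ∀ τ ∈ Icc (0 : ℝ) L, ∀ v,
      ⟪fderiv ℝ U (ODE.evolutionMap (fun _ : ℝ => selfSimilarTransport γ 0 V) 0 (-τ) y) v, v⟫ ≤ s₀ * ‖v‖ ^ 2)
    (hL : 0 ≤ L)
    (hy : ∀ σ ∈ Icc (0 : ℝ) L, ‖ODE.evolutionMap (fun _ : ℝ => selfSimilarTransport γ 0 V) 0 (-σ) y‖ ≤ M) :
    L ≤ Real.log (O / ‖curl U y‖) / (1 - s₀) := by
  have h := integral_one_sub_stretching_le_log_linger_orbit hprof hV hK hMR hVU hO hΩ (s := fun _ => s₀)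
    continuous_const hvisit hy L ⟨hL, le_rfl⟩
  rw [intervalIntegral.integral_const, smul_eq_mul, sub_zero] at h
  rw [le_div_iff₀ (by linarith)]
  linarith

/-- **(IM0) SUBCRITICAL-STRETCHING TIME IS SHORT (two-level majorant).**  With a continuous SPATIAL stretching majorant `s`
on `B̄_M` (`⟪DU(z)v, v⟫ ≤ s(z)‖v‖²`), bounded above by `S` there, and a level `q < S`: along the lingering orbit of a vortical
label `y`, for every `σ ∈ [0, L]` the time spent where `s ≤ q` obeys
`(S − q) · vol{τ ∈ [0, σ] : s(Ψ_τ y) ≤ q} ≤ log(O/‖Ω(y)‖) + (S − 1)σ`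
(split `∫₀^σ s(Ψ_τ y) dτ ≤ q·vol{s ≤ q} + S·vol{s > q}` against (T3) `σ − log(O/ω) ≤ ∫₀^σ s∘Ψ`).  With `S ≤ 1` the bound is
uniform in `σ`: the TOTAL time a lingering vortical orbit spends in the region `{λ_max(sym DU) ≤ q}` (e.g. near SOURCES of the
similarity wind, `q = 2γ + ε`) is `≤ log(O/ω)/(S − q)` — ROUND-41 §6 (IM0), the orbit-side companion of t40f (C3).
[folklore (Chebyshev)] -/
theorem volume_subcriticalStretching_le (hprof : IsSelfSimilarEulerProfile γ 0 U P) (hV : ContDiff ℝ 1 V)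
    {K : ℝ} (hK : ∀ y, ‖fderiv ℝ V y‖ ≤ K) {M Rbig : ℝ} (hMR : M < Rbig)
    (hVU : ∀ w ∈ ball (0 : EuclideanSpace ℝ (Fin 3)) Rbig, V w = U w)
    {s : EuclideanSpace ℝ (Fin 3) → ℝ} (hsc : Continuous s)
    (hs : ∀ z ∈ closedBall (0 : EuclideanSpace ℝ (Fin 3)) M, ∀ v, ⟪fderiv ℝ U z v, v⟫ ≤ s z * ‖v‖ ^ 2)
    {O : ℝ} (hO : ∀ z ∈ closedBall (0 : EuclideanSpace ℝ (Fin 3)) M, ‖curl U z‖ ≤ O)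
    {y : EuclideanSpace ℝ (Fin 3)} (hΩ : curl U y ≠ 0) {L : ℝ}
    (hy : ∀ σ ∈ Icc (0 : ℝ) L, ‖ODE.evolutionMap (fun _ : ℝ => selfSimilarTransport γ 0 V) 0 (-σ) y‖ ≤ M)
    {S q : ℝ} (hqS : q < S) (hsS : ∀ z ∈ closedBall (0 : EuclideanSpace ℝ (Fin 3)) M, s z ≤ S)
    {σ : ℝ} (hσ : σ ∈ Icc (0 : ℝ) L) :
    volume {τ ∈ Icc (0 : ℝ) σ |
        s (ODE.evolutionMap (fun _ : ℝ => selfSimilarTransport γ 0 V) 0 (-τ) y) ≤ q} ≤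
      ENNReal.ofReal ((Real.log (O / ‖curl U y‖) + (S - 1) * σ) / (S - q)) := by
  have hσ0 : 0 ≤ σ := hσ.1
  have hT3 := sub_log_le_integral_stretching_linger hprof hV hK hMR hVU hsc hs hO hΩ hy σ hσ
  -- the rate along the orbit, as a continuous function of backward time
  have hflow : Continuous fun t : ℝ => ODE.evolutionMap (fun _ : ℝ => selfSimilarTransport γ 0 V) 0 (-t) y :=
    continuous_flow_neg_apply (γ := γ) hV hK y
  set f : ℝ → ℝ := fun τ => s (ODE.evolutionMap (fun _ : ℝ => selfSimilarTransport γ 0 V) 0 (-τ) y) with hf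
  have hfc : Continuous f := hsc.comp hflow
  set t : Set ℝ := {τ | f τ ≤ q} with ht
  have htm : MeasurableSet t := (isClosed_le hfc continuous_const).measurableSet
  set A : Set ℝ := {τ ∈ Icc (0 : ℝ) σ |
    s (ODE.evolutionMap (fun _ : ℝ => selfSimilarTransport γ 0 V) 0 (-τ) y) ≤ q} with hA
  -- `A ⊆ (Ioc 0 σ ∩ t) ∪ {0}`
  have hAsub : A ⊆ (Ioc (0 : ℝ) σ ∩ t) ∪ {0} := by
    intro τ hτ
    rcases eq_or_lt_of_le hτ.1.1 with h0 | h0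
    · exact Or.inr (by simp [← h0])
    · exact Or.inl ⟨⟨h0, hτ.1.2⟩, hτ.2⟩
  -- the integral of the rate as a set integral over `Ioc 0 σ`, split along `t`
  have hI : ∫ τ in (0 : ℝ)..σ, s (ODE.evolutionMap (fun _ : ℝ => selfSimilarTransport γ 0 V) 0 (-τ) y) =
      ∫ τ in Ioc (0 : ℝ) σ, f τ := intervalIntegral.integral_of_le hσ0
  have hfi : IntegrableOn f (Ioc (0 : ℝ) σ) :=
    (hfc.continuousOn.integrableOn_compact isCompact_Icc).mono_set Ioc_subset_Icc_self
  have hsplit := integral_inter_add_sdiff htm hfi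
  have hzcl : ∀ τ ∈ Ioc (0 : ℝ) σ, ODE.evolutionMap (fun _ : ℝ => selfSimilarTransport γ 0 V) 0 (-τ) y ∈
      closedBall (0 : EuclideanSpace ℝ (Fin 3)) M :=
    fun τ hτ => mem_closedBall_zero_iff.2 (hy τ ⟨hτ.1.le, hτ.2.trans hσ.2⟩)
  have hfin1 : volume (Ioc (0 : ℝ) σ ∩ t) ≠ ⊤ := (measure_mono inter_subset_left).trans_lt measure_Ioc_lt_top |>.ne
  have hfin2 : volume (Ioc (0 : ℝ) σ \ t) ≠ ⊤ := (measure_mono sdiff_subset).trans_lt measure_Ioc_lt_top |>.ne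
  have hb1 : ∫ τ in Ioc (0 : ℝ) σ ∩ t, f τ ≤ (volume (Ioc (0 : ℝ) σ ∩ t)).toReal * q := by
    have h := setIntegral_mono_on (hfi.mono_set inter_subset_left) (integrableOn_const hfin1)
      (measurableSet_Ioc.inter htm) (fun τ hτ => hτ.2)
    rwa [setIntegral_const, smul_eq_mul, measureReal_def] at h
  have hb2 : ∫ τ in Ioc (0 : ℝ) σ \ t, f τ ≤ (volume (Ioc (0 : ℝ) σ \ t)).toReal * S := by
    have h := setIntegral_mono_on (hfi.mono_set sdiff_subset) (integrableOn_const hfin2)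
      (measurableSet_Ioc.diff htm) (fun τ hτ => hsS _ (hzcl τ hτ.1))
    rwa [setIntegral_const, smul_eq_mul, measureReal_def] at h
  have hab : (volume (Ioc (0 : ℝ) σ ∩ t)).toReal + (volume (Ioc (0 : ℝ) σ \ t)).toReal = σ := by
    have h := measure_inter_add_sdiff (μ := volume) (Ioc (0 : ℝ) σ) htm
    rw [Real.volume_Ioc, sub_zero] at h
    have h' := congrArg ENNReal.toReal h
    rwa [ENNReal.toReal_add hfin1 hfin2, ENNReal.toReal_ofReal hσ0] at h'
  -- `∫₀^σ s∘Ψ ≤ S σ − (S − q)·a`, `a := vol(Ioc 0 σ ∩ t)`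
  have hI2 : ∫ τ in (0 : ℝ)..σ, s (ODE.evolutionMap (fun _ : ℝ => selfSimilarTransport γ 0 V) 0 (-τ) y) ≤
      S * σ - (S - q) * (volume (Ioc (0 : ℝ) σ ∩ t)).toReal := by
    have hab' : (volume (Ioc (0 : ℝ) σ \ t)).toReal * S =
        σ * S - (volume (Ioc (0 : ℝ) σ ∩ t)).toReal * S := by
      linear_combination S * hab
    rw [hI, ← hsplit]
    linarith [hb1, hb2, hab']
  have hSq : 0 < S - q := sub_pos.2 hqS
  have hkey : (volume (Ioc (0 : ℝ) σ ∩ t)).toReal ≤ (Real.log (O / ‖curl U y‖) + (S - 1) * σ) / (S - q) := by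
    rw [le_div_iff₀ hSq]
    nlinarith [hT3, hI2]
  have hmain : volume (Ioc (0 : ℝ) σ ∩ t) ≤ ENNReal.ofReal ((Real.log (O / ‖curl U y‖) + (S - 1) * σ) / (S - q)) :=
    (ENNReal.le_ofReal_iff_toReal_le hfin1 (ENNReal.toReal_nonneg.trans hkey)).2 hkey
  calc volume A ≤ volume ((Ioc (0 : ℝ) σ ∩ t) ∪ {0}) := measure_mono hAsub
    _ ≤ volume (Ioc (0 : ℝ) σ ∩ t) + volume ({0} : Set ℝ) := measure_union_le _ _
    _ = volume (Ioc (0 : ℝ) σ ∩ t) := by rw [Real.volume_singleton, add_zero]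
    _ ≤ ENNReal.ofReal ((Real.log (O / ‖curl U y‖) + (S - 1) * σ) / (S - q)) := hmain

end Summit.NavierStokesRegularity.NavierStokesRegularity.Theorems.PowerGaugeEulerLiouville.NeedleClock

end
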